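import Summits.QuantumFields.BalabanUV.T4Continuum.Support.CoordSlabPoincare

/-!
# `BalabanUV.T4Continuum.Support.CoordSlabPoincareHi` — NE2 (node U1a) formalisation swarm, sub-row `T4-U1a.S-NE2-D1-DIRICHLET°`,
# supplier item «Δ1-HOLEFILL» (brick H-B, part 2b of 3): THE POINCARÉ INEQUALITY ON THE HIGH COORDINATE SLAB `{y μ ≥ 3k}` of the cube
# `Fin d → Fin 4k` by COORDINATE REVERSAL from the low-slab inequality of `CoordSlabPoincare`
# (unit b2b-balaban-t4-ne2-formalise-leaf-08, gen 6, file 2b — split off file 2 for the 400-line rule)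

HONEST FRAMING.  Rung (B)+1 bookkeeping at MODEL level; [folklore] finite lattice calculus; NE2 (U1a) is NOT proved by this file; spine
PROVED 0/9 unchanged; NOT infinite volume, NOT the mass gap, NOT Clay.  HONEST DEPENDENCY (verbatim): «continuum YM on T⁴ ⇐ BetaPertH ∧ nine
spine estimates (0/9 proved); BetaPertH ⇐ (D1) ∧ (D4) ∧ CAP+tail; G-an2-4 gates asym, D1 and NE2/3/4.»

WHAT THIS FILE PROVES (0 sorry).  `hi μ k = {y : n + 1 ≤ y μ + k}`; the reversal `revPt` (`y μ ↦ n − y μ`) is an involution exchanging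
`lo μ k` and `hi μ k` and commuting with transversal steps; under it the variance and the slab Dirichlet form of `F ∘ revPt` over `lo μ k`
are those of `F` over `hi μ k` (`cvar_revPt`, `dirOn_revPt`: each longitudinal bond maps to a bond reversed, `revPt y = phi y + e_μ`);
hence **`cvar_hi_le`**: for `4k = n + 1`, `cvar (hi μ k) F ≤ (n(n+1)/2)·dirOn (hi μ k) F`.

ABSOLUTE RULE (cell, verbatim): «No internally-minted statement may enter as a cited fact. Every hypothesis is either kernel-proved in
this package or a verbatim quotation of a PUBLISHED theorem with page reference. The manuscript(s) under audit are NOT citable for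
their own disputed steps — they are the thing under adjudication; programme-internal (2001/route/tribunal) claims are never citable.»
[folklore]; plain data `def`s (`hi`, `revPt`, `phi`), no `def … : Prop` fact.  NOT CLAIMED: anything analytic; NE2.
-/

noncomputable section

open scoped BigOperators ComplexConjugate
open Finset

namespace Summit.QuantumFields.BalabanUV.T4Continuum.CoordSlabPoincareHi

open Literature.MathematicalPhysics.QuantumFieldTheory.Balaban1983to89.Beta.CoordCubePoincare (stepUp)
open Summit.QuantumFields.BalabanUV.T4Continuum.FiniteVarianceGluing (cvar cvar_comp_of_cover)
open Summit.QuantumFields.BalabanUV.T4Continuum.CoordSlabPoincare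

variable {n d : ℕ}

/-! ## §5 The high slab by coordinate reversal -/

section HiSlab

variable (μ : Fin d) (k : ℕ)

/-- the HIGH SLAB `{y : y μ ≥ n + 1 − k}` of the coordinate cube. [folklore] -/
def hi : Finset (Fin d → Fin (n + 1)) := univ.filter (fun y : Fin d → Fin (n + 1) => n + 1 ≤ (y μ : ℕ) + k)

/-- membership in the high slab. [folklore] -/
theorem mem_hi {y : Fin d → Fin (n + 1)} : y ∈ hi (n := n) μ k ↔ n + 1 ≤ (y μ : ℕ) + k := by simp [hi]

omit k in
/-- COORDINATE REVERSAL in direction `μ`: `y μ ↦ n − y μ`. [folklore] -/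
def revPt (y : Fin d → Fin (n + 1)) : Fin d → Fin (n + 1) := Function.update y μ (Fin.rev (y μ))

omit k in
/-- the reversed digit. [folklore] -/
theorem val_revPt (y : Fin d → Fin (n + 1)) : ((revPt (n := n) μ y μ : Fin (n + 1)) : ℕ) = n - (y μ : ℕ) := by
  rw [revPt, Function.update_self, Fin.val_rev]; omega

omit k in
/-- the other digits are untouched. [folklore] -/
theorem revPt_apply_ne (y : Fin d → Fin (n + 1)) {ν : Fin d} (hν : ν ≠ μ) : revPt (n := n) μ y ν = y ν := by
  rw [revPt, Function.update_of_ne hν]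

omit k in
/-- reversal is an involution. [folklore] -/
theorem revPt_revPt (y : Fin d → Fin (n + 1)) : revPt (n := n) μ (revPt μ y) = y :=
  ext_of_digit μ (by rw [val_revPt, val_revPt]; have := (y μ).isLt; omega)
    (fun ν hν => by rw [revPt_apply_ne μ _ hν, revPt_apply_ne μ _ hν])

/-- reversal maps the high slab onto the low slab … [folklore] -/
theorem revPt_mem_lo_iff (y : Fin d → Fin (n + 1)) : revPt (n := n) μ y ∈ lo (n := n) μ k ↔ y ∈ hi (n := n) μ k := by
  rw [mem_lo, mem_hi, val_revPt]; have := (y μ).isLt; omega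

/-- … and the low slab onto the high slab. [folklore] -/
theorem revPt_mem_hi_iff (y : Fin d → Fin (n + 1)) : revPt (n := n) μ y ∈ hi (n := n) μ k ↔ y ∈ lo (n := n) μ k := by
  rw [mem_lo, mem_hi, val_revPt]; have := (y μ).isLt; omega

/-- reversal is a BIJECTION `lo k → hi k`: `Σ_{lo k} g ∘ revPt = Σ_{hi k} g`. [folklore] -/
theorem sum_lo_revPt {β : Type*} [AddCommMonoid β] (g : (Fin d → Fin (n + 1)) → β) :
    ∑ y ∈ lo (n := n) μ k, g (revPt μ y) = ∑ y ∈ hi (n := n) μ k, g y :=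
  Finset.sum_nbij' (revPt μ) (revPt μ) (fun y hy => (revPt_mem_hi_iff μ k y).mpr hy) (fun y hy => (revPt_mem_lo_iff μ k y).mpr hy)
    (fun y _ => revPt_revPt μ y) (fun y _ => revPt_revPt μ y) (fun _ _ => rfl)

/-- the variance of the reversed function over the low slab is the variance over the high slab. [folklore] -/
theorem cvar_revPt (F : (Fin d → Fin (n + 1)) → ℂ) : cvar (lo (n := n) μ k) (F ∘ revPt μ) = cvar (hi (n := n) μ k) F := by
  have h := (cvar_comp_of_cover (s := lo (n := n) μ k) (s' := hi (n := n) μ k) (π := revPt μ) (k := 1) one_ne_zero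
    (fun g => by rw [sum_lo_revPt μ k g, Nat.cast_one, one_mul]) F).2
  rw [h, Nat.cast_one, one_mul]

omit k in
/-- reversal commutes with transversal steps. [folklore] -/
theorem revPt_stepUp_ne {ν : Fin d} (hν : ν ≠ μ) (y : Fin d → Fin (n + 1)) :
    revPt (n := n) μ (stepUp y ν) = stepUp (revPt μ y) ν := by
  funext l
  by_cases hl1 : l = μ
  · subst hl1
    simp only [revPt, stepUp, Function.update_self, Function.update_of_ne hν, Function.update_of_ne (Ne.symm hν)]
  · by_cases hl2 : l = ν
    · subst hl2
      simp only [revPt, stepUp, Function.update_self, Function.update_of_ne hl1]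
    · simp only [revPt, stepUp, Function.update_of_ne hl1, Function.update_of_ne hl2]

/-- a TRANSVERSAL term over a high slab is a sum over the slab. [folklore] -/
theorem dirTerm_hi_ne {ν : Fin d} (hν : ν ≠ μ) (G : (Fin d → Fin (n + 1)) → ℂ) :
    dirTerm (hi (n := n) μ k) G ν = ∑ y ∈ hi (n := n) μ k, (if y ν ≠ Fin.last n then ‖G (stepUp y ν) - G y‖ ^ 2 else 0) := by
  rw [dirTerm]
  have hset : univ.filter (fun y : Fin d → Fin (n + 1) => y ν ≠ Fin.last n ∧ y ∈ hi (n := n) μ k ∧ stepUp y ν ∈ hi (n := n) μ k)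
      = (hi (n := n) μ k).filter (fun y : Fin d → Fin (n + 1) => y ν ≠ Fin.last n) := by
    ext y
    simp only [mem_filter, mem_univ, true_and, mem_hi, stepUp_apply_ne y (Ne.symm hν)]
    tauto
  rw [hset, Finset.sum_filter]

/-- TRANSVERSAL terms: `dirTerm (lo k) (F ∘ revPt) ν = dirTerm (hi k) F ν`. [folklore] -/
theorem dirTerm_revPt_ne {ν : Fin d} (hν : ν ≠ μ) (F : (Fin d → Fin (n + 1)) → ℂ) :
    dirTerm (lo (n := n) μ k) (F ∘ revPt μ) ν = dirTerm (hi (n := n) μ k) F ν := by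
  rw [dirTerm_lo_ne μ k hν, dirTerm_hi_ne μ k hν]
  set g : (Fin d → Fin (n + 1)) → ℝ := fun y => if y ν ≠ Fin.last n then ‖F (stepUp y ν) - F y‖ ^ 2 else 0 with hg
  have hrw : ∀ y, (if y ν ≠ Fin.last n then ‖(F ∘ revPt μ) (stepUp y ν) - (F ∘ revPt μ) y‖ ^ 2 else 0) = g (revPt μ y) := by
    intro y
    simp only [hg, Function.comp, revPt_stepUp_ne μ hν, revPt_apply_ne μ y hν]
  simp_rw [hrw]
  exact sum_lo_revPt μ k g

omit k in
/-- the reversal of the stepped point: the reindexing map of the longitudinal bonds. [folklore] -/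
def phi (y : Fin d → Fin (n + 1)) : Fin d → Fin (n + 1) := revPt μ (stepUp y μ)

omit k in
/-- its `μ`-digit. [folklore] -/
theorem val_phi {y : Fin d → Fin (n + 1)} (hy : (y μ : ℕ) + 1 ≤ n) : ((phi (n := n) μ y μ : Fin (n + 1)) : ℕ) = n - (y μ : ℕ) - 1 := by
  have hne : y μ ≠ Fin.last n := by
    intro h; have := congrArg Fin.val h; rw [Fin.val_last] at this; omega
  rw [phi, val_revPt, val_stepUp hne]; omega

omit k in
/-- its other digits. [folklore] -/
theorem phi_apply_ne (y : Fin d → Fin (n + 1)) {ν : Fin d} (hν : ν ≠ μ) : phi (n := n) μ y ν = y ν := by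
  rw [phi, revPt_apply_ne μ _ hν, stepUp_apply_ne _ hν]

omit k in
/-- `phi` is an involution off the last layer. [folklore] -/
theorem phi_phi {y : Fin d → Fin (n + 1)} (hy : (y μ : ℕ) + 1 ≤ n) : phi (n := n) μ (phi μ y) = y := by
  have h1 := val_phi μ hy
  refine ext_of_digit μ ?_ fun ν hν => by rw [phi_apply_ne μ _ hν, phi_apply_ne μ _ hν]
  rw [val_phi μ (by rw [h1]; omega), h1]; omega

omit k in
/-- the reversed bond: `revPt y = phi y + e_μ`. [folklore] -/
theorem revPt_eq_stepUp_phi {y : Fin d → Fin (n + 1)} (hy : (y μ : ℕ) + 1 ≤ n) : revPt (n := n) μ y = stepUp (phi μ y) μ := by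
  have h1 := val_phi μ hy
  have hne : phi (n := n) μ y μ ≠ Fin.last n := by
    intro h; have := congrArg Fin.val h; rw [Fin.val_last] at this; omega
  refine ext_of_digit μ ?_ fun ν hν => by rw [revPt_apply_ne μ _ hν, stepUp_apply_ne _ hν, phi_apply_ne μ _ hν]
  rw [val_revPt, val_stepUp hne, h1]; omega

/-- the LONGITUDINAL term over a high slab is the sum over `{y μ + 1 ≤ n, n + 1 ≤ y μ + k}`. [folklore] -/
theorem dirTerm_hi_self (G : (Fin d → Fin (n + 1)) → ℂ) :
    dirTerm (hi (n := n) μ k) G μ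
      = ∑ y ∈ univ.filter (fun y : Fin d → Fin (n + 1) => (y μ : ℕ) + 1 ≤ n ∧ n + 1 ≤ (y μ : ℕ) + k), ‖G (stepUp y μ) - G y‖ ^ 2 := by
  rw [dirTerm]
  refine Finset.sum_congr ?_ fun _ _ => rfl
  ext y
  simp only [mem_filter, mem_univ, true_and, mem_hi]
  constructor
  · rintro ⟨h1, h2, _⟩
    have : (y μ : ℕ) ≠ n := fun h => h1 (Fin.ext (by rw [h, Fin.val_last]))
    have := (y μ).isLt
    exact ⟨by omega, h2⟩
  · rintro ⟨h1, h2⟩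
    have hne : y μ ≠ Fin.last n := by
      intro h'; have := congrArg Fin.val h'; rw [Fin.val_last] at this; omega
    refine ⟨hne, h2, ?_⟩; rw [val_stepUp hne]; omega

/-- LONGITUDINAL term: `dirTerm (lo k) (F ∘ revPt) μ = dirTerm (hi k) F μ` (each bond maps to a bond reversed). [folklore] -/
theorem dirTerm_revPt_self (hk : k ≤ n + 1) (F : (Fin d → Fin (n + 1)) → ℂ) :
    dirTerm (lo (n := n) μ k) (F ∘ revPt μ) μ = dirTerm (hi (n := n) μ k) F μ := by
  rw [dirTerm_lo_self μ hk, dirTerm_hi_self μ k]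
  have hrw : ∀ y ∈ univ.filter (fun y : Fin d → Fin (n + 1) => (y μ : ℕ) + 1 < k),
      ‖(F ∘ revPt μ) (stepUp y μ) - (F ∘ revPt μ) y‖ ^ 2 = ‖F (stepUp (phi μ y) μ) - F (phi μ y)‖ ^ 2 := by
    intro y hy
    rw [mem_filter] at hy
    simp only [Function.comp]
    rw [revPt_eq_stepUp_phi μ (y := y) (by omega), ← phi, norm_sub_rev]
  rw [Finset.sum_congr rfl hrw]
  refine Finset.sum_nbij' (phi μ) (phi μ) ?_ ?_ ?_ ?_ ?_
  · intro y hy; rw [mem_filter] at hy; rw [mem_filter, val_phi μ (by omega)]; refine ⟨mem_univ _, ?_, ?_⟩ <;> omega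
  · intro y hy; rw [mem_filter] at hy; rw [mem_filter, val_phi μ hy.2.1]; exact ⟨mem_univ _, by omega⟩
  · intro y hy; rw [mem_filter] at hy; exact phi_phi μ (by omega)
  · intro y hy; rw [mem_filter] at hy; exact phi_phi μ hy.2.1
  · intro y _; rfl

/-- `dirOn (lo k) (F ∘ revPt) = dirOn (hi k) F`. [folklore] -/
theorem dirOn_revPt (hk : k ≤ n + 1) (F : (Fin d → Fin (n + 1)) → ℂ) :
    dirOn (lo (n := n) μ k) (F ∘ revPt μ) = dirOn (hi (n := n) μ k) F := by
  rw [dirOn_eq_sum_dirTerm, dirOn_eq_sum_dirTerm]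
  refine Finset.sum_congr rfl fun ν _ => ?_
  by_cases hν : ν = μ
  · subst hν; exact dirTerm_revPt_self ν k hk F
  · exact dirTerm_revPt_ne μ k hν F

/-- **POINCARÉ ON THE HIGH SLAB**: for `4k = n + 1`, `cvar (hi μ k) F ≤ (n(n+1)/2)·dirOn (hi μ k) F`. [folklore] -/
theorem cvar_hi_le (hk : 4 * k = n + 1) (F : (Fin d → Fin (n + 1)) → ℂ) :
    cvar (hi (n := n) μ k) F ≤ (n : ℝ) * (n + 1) / 2 * dirOn (hi (n := n) μ k) F := by
  rw [← cvar_revPt μ k F, ← dirOn_revPt μ k (by omega) F]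
  exact cvar_lo_le μ k hk (F ∘ revPt μ)

end HiSlab

end Summit.QuantumFields.BalabanUV.T4Continuum.CoordSlabPoincareHi

end
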